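import Literature.MathematicalPhysics.QuantumFieldTheory.Balaban1983to89.T3Thm1Carrier
import Literature.MathematicalPhysics.QuantumFieldTheory.Balaban1983to89.B11Prop8Assembly
import HarnessLib

/-!
# `Balaban1983to89.T3Thm1CarrierNative` — [Balaban1985Variational] Proposition 7 (from a background (14)), Proposition 8 and the
# Sect. F conclusion (169) ⇒ (9)–(10), READ AT THE T³ FAMILY'S CARRIER `T3Thm1Carrier.famX L` IN NATIVE FORM: the three LQB statements
# `B11.Prop8Printed B₃ (famX L)`, `B11.SectFPrinted B₃ (famX L)` and «Prop 7 from a background (14)» — the leaves V2 ∕ V4 ∕ V3 of the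
# ym3 item stmt-QuantumFields-19200 (`Summit…Variational.thm1At_fam_of_prop7_prop8_sectF`, `…stub_variational_of_leaves`) — UNFOLDED ONCE,
# kernel-checked, into statements about `SU(2)` lattice gauge fields of the family (`RegPr`, `fibre`, `regFibrePr`, `PlaqSmall`,
# `wilsonAction4`, `covDerivT`∕`plaqFT`), with the converse edges to the ym3 birth's own schemas `MinimisersIn8At` ∕ `MinimiserCurvGradAt`

statement-level skeleton of published theorems with citation tags; proofs where landed; nothing here is a claim about the Yang–Mills mass gap

T. Bałaban, *The variational problem and background fields in renormalization group method for lattice gauge theories*, Commun. Math.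
Phys. **102** (1985) 277–309 [Balaban1985Variational] (cell paper B11).  PDF held: `paper:balaban1985-cmp102-variational-background`
(journal page = PDF page + 276); pp. 278–279 [PDF 2–3], 299 [PDF 23], 304–305 [PDF 28–29] read by this seat from the text layer and the
x2 page renders `…/b2b-balaban-ref1/pages/1985-cmp102-variational-background/…-p003-x2.png, …-p023-x2.png`.

CITATION HEADER (lean-in-tree rule 2026-08-18).  WHAT IS REPRODUCED: nothing new of the paper is TYPED here — the typed statements of
record are `B11.Prop7Printed` (Prop. 7 p. 299), `B11.Prop8Printed` (Prop. 8 p. 304), `B11.SectFPrinted` (Sect. F (169) p. 305 ⇒ (9)–(10)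
p. 279) in `…Balaban1983to89.B11`, `B11Thm1.Prop7From14` (Prop. 7 proved FROM a background (14), cell gap G-pv12-1), and the d = 3 carrier
`T3Thm1Carrier.varProblem3` ∕ `famX` with its declared readings R1–R3.  THIS FILE is the typer's service to the CONSUMERS of those
statements at the d = 3 carrier (director-ym R141 (B), seat `lit-balaban-type-B11`: *«`Prop8Printed`∕`SectFPrinted` consumers of 19200
V2∕V4»*): the by-name UNFOLDING of each leaf into the T³ family's own vocabulary, both directions, so that a prover of V2∕V3∕V4 works on a
lattice statement and hands back the LQB statement by `Iff.mpr`.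

THE PRINT (verbatim).  Prop. 8 p. 304 [PDF 28]: *«There exists a positive, absolute constant a₅ such, that if U is a critical configuration
of (5) in the space (6) with V satisfying (7), and if ε₀ ≦ a₅, then U belongs to the space (8).»*  Sect. F p. 305 [PDF 29]: *«… hence we
have proved the regularity conditions (9), (10), and the proof of Theorem 1 is completed.»*, with (9)–(10) p. 279 [PDF 3]: *«for an
arbitrary cube □ in the class described above, of a size 2MLʲη, M ≦ M(ε₁), there exists a gauge transformation u defined on a neighborhood
of □ and such that on □, U^{u⁻¹} = e^{iηA}, |A| < B₃Mε₁(Lʲη)⁻¹, |∇^ηA| < B₃Mε₁(Lʲη)⁻², ‖A‖_{1,β} < B₄(β₀)Mε₁(Lʲη)^{−2−β} for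
0 ≦ β ≦ β₀ = 1, (9) |∂^{η*}∂^ηA|, |Δ^ηA| < B₃Mε₁(Lʲη)⁻³. (10)»*  Prop. 7 p. 299 [PDF 23]: *«There exist positive, absolute constants a₀,
a′₁ such that for ε₀ ≦ a₀ and B₃ε₁ ≦ ε₀ the variational problem (5), (6) has at most one critical orbit. If ε₁ ≦ a′₁, then there exists a
minimal orbit in the space (6) with ε₀ = O(1)C₁B₃ε₁.»*

WHAT IS CERTIFIED (kernel, sorry-free; axioms `propext` ∕ `Classical.choice` ∕ `Quot.sound`; no instance, no notation).
§1 `IsCritR2` — the carrier's reading R2 of «critical configuration of (5) in (6)» NAMED (`isCritical_famX_iff : … ↔ …` by `Iff.rfl`), and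
   its non-vacuity at the flat datum (`isCritR2_one`).
§2 (V2) `Prop8NativeAt L a₅ B₃` — Prop. 8 at the carrier as a lattice statement; **`prop8Printed_famX_iff_native`** (pure unfolding) and
   **`prop8Printed_famX_iff_minimisersIn8At : 0 < B₃ → (B11.Prop8Printed B₃ (famX L) ↔ ∃ a₅ > 0, ∀ a₁, MinimisersIn8At L a₅ a₁ B₃)`** — the
   CONVERSE of `T3Thm1Carrier.minimisersIn8At_of_prop8` (a reading-R2-critical configuration minimises over (6) at the radius min{e, ε₀};
   monotonicity of (6) in the radius, `regFibrePr_mono`).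
§3 (V4) `CritCurvGradAt L a₁ B₃ B₄` — the ONE surviving member of (9)–(10) at the carrier; **`sectFPrinted_famX_iff : 0 < B₃ →
   (B11.SectFPrinted B₃ (famX L) ↔ ∃ a₁ B₄ > 0, CritCurvGradAt L a₁ B₃ B₄)`**: in reading R3 (point data, M = 1, Lʲη = 1) the members |A|,
   |∇^ηA| of (9) READ AS 0 and the member (10) reads as (8)'s own covariant-divergence clause (`ineq10_famX_of_regPr`, [Balaban1985RegularSpaces]
   (1.9)), so the Sect. F conclusion at this carrier IS EXACTLY the β₀ = 1 Hölder member of (9) read as the covariant gradient of the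
   curvature of (8)-regular critical configurations, `‖(D^{1*}_{U,ν}F_{κκ′})(x)‖ < B₄ε₁L^{−3(K−n)}`; + `minimiserCurvGradAt_of_native`
   (V2-native ∧ V4-native ⇒ the ym3 birth's `MinimiserCurvGradAt`, the natively-proved twin of `T3Thm1Carrier.minimiserCurvGradAt_of_thm1At`),
   and non-vacuity of V4's conclusion at the flat datum (`curvGrad_one`).
§4 (V3) `Prop7From14At L B₃` — the HYPOTHESIS `H7` of `Summit…Variational.thm1At_fam_of_prop7_prop8_sectF` NAMED (same formula, so the
   consumer's `H7` is `Prop7From14At L B₃` by `Iff.rfl`∕unfolding), `Prop7From14NativeAt`, **`prop7From14At_iff_native`**.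
§5 (V2, one step; v1.2) `HalvingNativeAt L a₅ B₃` — the located hypothesis `B11Prop8Assembly.HalvingStep` (Sect. F first case, p. 304 «U_k belongs
   to the space (2) with max{B₃ε₁, ½ε₀} instead of ε₀») at the carrier, native; `halvingStep_famX_iff_native`; **`prop8Printed_famX_of_halvingNative`**
   (V2 ⇐ the native one-step statement, the iteration «We continue this way» being `prop8Printed_of_halvingStep` by name).

LOCATED FINDING (for the 19200 owner ∕ director; count-neutral, not a ruling): by §3, leaf V4 at the d = 3 carrier carries NO content of
Sect. F's displayed chain (152)–(168) beyond Prop. 8 — what survives is print's Hölder clause of (9) at β₀ = 1, which the paper does NOT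
derive (cell GAPS.md **G-B11-F3**: *«the printed derivation ((152), (164)–(169)) bounds |A|, |∇^ηA|, |∂^{η*}∂^ηA|, |Δ^ηA| only — the Hölder
clause … is not derived and B₄ is never defined in the paper (the only available source, (1.36) of [6] Thm 2, is stated for β ≦ β₀ < 1)»*);
DOWNSTREAM the series never uses β₀ = 1 either — [Balaban1987RG1] (3.31) p. 276 [PDF 28] – (3.32) p. 277 [PDF 29] assumes *«|A|, |∇^ηA|, ‖A‖_{1,β} < α₂
on □₀, (3.31) for 0 ≦ β ≦ β₀ < 1»* (locator erratum of v1.1∕v1.2 fixed in v1.3, ref-2 g138 PASS 21∕21), the SOURCE [Balaban1985RegularSpaces] p. 83 [PDF 9]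
says of (1.36) *«This condition describes fully regularity properties of the first order derivatives. Such information is unavailable for the
second order derivatives, but we have the following bounds for the second order operators acting on A: [(1.39)]»*, and p. 285 [PDF 37] before
(4.18) of [Balaban1987RG1] says verbatim *«For second order derivatives we have a weaker conclusion, because we
do not have bounds for second order derivatives of the field A, only for Hölder norms of first order derivatives in (3.32)»*.  So the surviving
member of V4 in `T3Thm1Carrier`'s reading R3 (a POINTWISE bound on the covariant gradient of the curvature = second differences of A) is
STRONGER than anything the Bałaban series prints or consumes; a 19200 seat proving V4 proves a new lattice estimate, not a printed one.
HONEST SCOPE: nothing of [Balaban1985Variational] is proved or asserted; every statement of the paper enters as one side of an `Iff` or as a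
hypothesis; the readings R1–R3 are `T3Thm1Carrier`'s, unchanged; no new named fact (the four `def`s are hypothesis SCHEMAS, each proved
EQUIVALENT to an existing typed statement at the carrier).  Mega-formalization `lit-balaban`, HOME `run/shared/lean/pub/lit-balaban/`, typer
seat `lit-balaban-type-B11` gen 0 (director-ym R141 (B)); consumers: ym3 `stmt-QuantumFields-19200` leaves V2∕V3∕V4 (fleet seats
`ym-ust-19200-p1∕-p2`, owner `ym3-torus-plan`).  Imports `T3Thm1Carrier` and `B11Prop8Assembly` only; modifies nothing.
-/

noncomputable section

open MeasureTheory Filter Topology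
open scoped Matrix.Norms.L2Operator
open Literature.MathematicalPhysics.QuantumFieldTheory.Balaban1983to89.T3ContinuumYM3Torus
open Literature.MathematicalPhysics.QuantumFieldTheory.Balaban1983to89.T3UnitLawDensityEML (ℰp measurableE_ℰp)
open Literature.MathematicalPhysics.QuantumFieldTheory.Balaban1983to89.T3UnitScaleTilt
open Literature.MathematicalPhysics.QuantumFieldTheory.Balaban1983to89.T3TiltDescent
open Literature.MathematicalPhysics.QuantumFieldTheory.Balaban1983to89.T3CruxEstimates
open Literature.MathematicalPhysics.QuantumFieldTheory.Balaban1983to89.T3ConstrainedMinimiser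
open Literature.MathematicalPhysics.QuantumFieldTheory.Balaban1983to89.T3DescentFibreTower
open Literature.MathematicalPhysics.QuantumFieldTheory.Balaban1983to89.T3RegularMinimiser
open Literature.MathematicalPhysics.QuantumFieldTheory.Balaban1983to89.T3PrintedRegularMinimiser
open Literature.MathematicalPhysics.QuantumFieldTheory.Balaban1983to89.T3PrintedRegularOrbits (descTransf)
open Literature.MathematicalPhysics.QuantumFieldTheory.Balaban1983to89.T3PrintedMinimiserExistence
open Literature.MathematicalPhysics.QuantumFieldTheory.Balaban1983to89.T3LowerAlongMinimisersSplit
open Literature.MathematicalPhysics.QuantumFieldTheory.Balaban1983to89.T3AvgDivergenceSplit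
open Literature.MathematicalPhysics.QuantumFieldTheory.Balaban1983to89.B10Eq27TorusAxialLog (toUField unitsField holT_one)
open Literature.MathematicalPhysics.QuantumFieldTheory.Balaban1983to89.B10Eq68TorusRegularity (plaqFT covDerivT covDivT)
open Literature.MathematicalPhysics.QuantumFieldTheory.Balaban1983to89.B7Eq78Linearization (conjR conjR_apply)
open Literature.MathematicalPhysics.QuantumFieldTheory.Balaban1983to89.B11 (VarProblem VarProblemX Regularity Prop8Printed SectFPrinted)
open Literature.MathematicalPhysics.QuantumFieldTheory.Balaban1983to89.T3Thm1Carrier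
open Literature.MathematicalPhysics.QuantumFieldTheory.Balaban1983to89.Missing

namespace Literature.MathematicalPhysics.QuantumFieldTheory.Balaban1983to89.T3Thm1CarrierNative

/-! ## §1 Reading R2 of «critical configuration of (5) in the space (6)» at the carrier, named -/

section Critical

variable (F : T3Family) (n K : ℕ) (h : n ≤ K)

/-- **READING R2 OF «U IS A CRITICAL CONFIGURATION OF (5) IN (6)»** (the field `IsCritical` of `T3Thm1Carrier.varProblem3`, verbatim, named):
`U` MINIMISES the Wilson action over print's regular fibre `(6)(e) = 𝔘_k(e) ∩ 𝔅_k(V)` of the family at SOME radius `e > 0` (a minimiser over the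
open space (6) is a critical point of (5) on the constraint manifold 𝔅_k(V); criticality on `SU(2)^{bonds}` is not typed — `T3Thm1Carrier`
reading R2, weaker than print). [cite: Balaban1985Variational, (5)-(6) p.278, Prop 8 p.304] -/
def IsCritR2 (V : GaugeField (F.P n) 0 (Matrix.specialUnitaryGroup (Fin 2) ℂ))
    (U : GaugeField (F.P K) 0 (Matrix.specialUnitaryGroup (Fin 2) ℂ)) : Prop :=
  ∃ e : ℝ, 0 < e ∧ U ∈ regFibrePr F n K h e V ∧
    IsMinOn (fun W : GaugeField (F.P K) 0 (Matrix.specialUnitaryGroup (Fin 2) ℂ) => wilsonAction4 W) (regFibrePr F n K h e V) U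

variable {F n K h}

/-- The carrier's `IsCritical` IS `IsCritR2` (definitional). [cite: Balaban1985Variational, Prop 8 p.304] -/
theorem isCritical_famX_iff {L : ℕ} (hF : F.L = L) (hnK : n < K) (V : GaugeField (F.P n) 0 (Matrix.specialUnitaryGroup (Fin 2) ℂ))
    (U : GaugeField (F.P K) 0 (Matrix.specialUnitaryGroup (Fin 2) ℂ)) :
    (famX L ⟨(F, n, K), hF, hnK⟩).IsCritical V U ↔ IsCritR2 F n K hnK.le V U :=
  Iff.rfl

/-- A minimiser over (6)(ε₀), `ε₀ > 0`, is critical in reading R2 (with `e = ε₀`). [cite: Balaban1985Variational, (6) p.278] -/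
theorem isCritR2_of_isMinOn {ε₀ : ℝ} (hε₀ : 0 < ε₀) {V : GaugeField (F.P n) 0 (Matrix.specialUnitaryGroup (Fin 2) ℂ)}
    {U : GaugeField (F.P K) 0 (Matrix.specialUnitaryGroup (Fin 2) ℂ)} (hU : U ∈ regFibrePr F n K h ε₀ V)
    (hmin : IsMinOn (fun W : GaugeField (F.P K) 0 (Matrix.specialUnitaryGroup (Fin 2) ℂ) => wilsonAction4 W) (regFibrePr F n K h ε₀ V) U) :
    IsCritR2 F n K h V U :=
  ⟨ε₀, hε₀, hU, hmin⟩

/-- `A(1) = 0` on every lattice of the family (`minAction_self`, `minAction_one`). [cite: Balaban1985Variational, (5) p.278] -/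
theorem wilsonAction4_one_eq_zero :
    wilsonAction4 (1 : GaugeField (F.P K) 0 (Matrix.specialUnitaryGroup (Fin 2) ℂ)) = 0 := by
  rw [← minAction_self F ℰp K 1]
  exact minAction_one F ℰp expMeanLogSU_E_one le_rfl

/-- **NON-VACUITY of reading R2**: the trivial configuration is critical over the flat datum (`1 ∈ (6)(e)(1)` for every `e > 0`,
`A(1) = 0 ≤ A(W)`). [cite: Balaban1985Variational, (5)-(6) p.278] -/
theorem isCritR2_one : IsCritR2 F n K h (1 : GaugeField (F.P n) 0 (Matrix.specialUnitaryGroup (Fin 2) ℂ))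
    (1 : GaugeField (F.P K) 0 (Matrix.specialUnitaryGroup (Fin 2) ℂ)) := by
  refine ⟨1, one_pos, one_mem_regFibrePr_one F one_pos, fun W _ => ?_⟩
  show wilsonAction4 (1 : GaugeField (F.P K) 0 (Matrix.specialUnitaryGroup (Fin 2) ℂ)) ≤ wilsonAction4 W
  rw [wilsonAction4_one_eq_zero]
  exact wilsonAction4_nonneg W

end Critical

/-! ## §2 (V2) Proposition 8 at the carrier in native form; the converse edge to `MinimisersIn8At` -/

section Prop8

/-- **[Balaban1985Variational] PROP. 8 AT THE T³ CARRIER, NATIVE FORM** (hypothesis schema, never asserted): for every member `F` of block size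
`L`, heights `n < K`, `0 < ε₁`, `ε₀ ≦ a₅`, every (7)-datum `V` (`PlaqSmall ε₁ V`) and every `U ∈ 𝔘_k(ε₀)` (`RegPr`, both clauses of (2)) in the
(0.4)-descent fibre of `V` which is critical in reading R2: `U ∈ 𝔘_k(B₃ε₁)` — print's *«if U is a critical configuration of (5) in the space (6)
with V satisfying (7), and if ε₀ ≦ a₅, then U belongs to the space (8)»*, (8) = 𝔘_k(B₃ε₁) ∩ 𝔅_k(V). [cite: Balaban1985Variational, Prop 8 p.304] -/
def Prop8NativeAt (L : ℕ) (a₅ B₃ : ℝ) : Prop :=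
  ∀ F : T3Family, F.L = L → ∀ (n K : ℕ) (hnK : n < K) (ε₀ ε₁ : ℝ), 0 < ε₁ → ε₀ ≤ a₅ →
    ∀ (V : GaugeField (F.P n) 0 (Matrix.specialUnitaryGroup (Fin 2) ℂ)) (U : GaugeField (F.P K) 0 (Matrix.specialUnitaryGroup (Fin 2) ℂ)),
      PlaqSmall ε₁ V → RegPr F n K ε₀ U → U ∈ fibre F ℰp n K hnK.le V → IsCritR2 F n K hnK.le V U → RegPr F n K (B₃ * ε₁) U

/-- **V2 UNFOLDED**: `B11.Prop8Printed B₃ (famX L)` IS `∃ a₅ > 0, Prop8NativeAt L a₅ B₃` (definitional unfolding of the carrier, member by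
member). [cite: Balaban1985Variational, Prop 8 p.304] -/
theorem prop8Printed_famX_iff_native {L : ℕ} {B₃ : ℝ} :
    Prop8Printed B₃ (famX L) ↔ ∃ a₅ : ℝ, 0 < a₅ ∧ Prop8NativeAt L a₅ B₃ := by
  constructor
  · rintro ⟨a₅, ha₅, H⟩
    refine ⟨a₅, ha₅, fun F hF n K hnK ε₀ ε₁ hε₁ hε₀ V U hV hU hB hcrit => ?_⟩
    exact H ⟨(F, n, K), hF, hnK⟩ ε₀ ε₁ hε₁ V U hV hU hB hcrit hε₀
  · rintro ⟨a₅, ha₅, H⟩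
    refine ⟨a₅, ha₅, fun i ε₀ ε₁ hε₁ V U hV hU hB hcrit hε₀ => ?_⟩
    obtain ⟨⟨F, n, K⟩, hF, hnK⟩ := i
    exact H F hF n K hnK ε₀ ε₁ hε₁ hε₀ V U hV hU hB hcrit

/-- **THE CONVERSE EDGE**: the ym3 birth's schema `MinimisersIn8At L a₅ a₁ B₃` for every `a₁` («minimisers over (6)(ε₀) lie in (8), window
`B₃ε₁ ≦ ε₀ ≦ a₅`») GIVES Prop. 8 at the carrier in native form — a reading-R2-critical `U ∈ 𝔘_k(ε₀)` minimises over (6) at the radius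
`r = min{e, ε₀} ≦ a₅` (it lies in both spaces; (6) is monotone in the radius), and either `B₃ε₁ ≦ r` (the schema applies at `a₁ := ε₁`) or
`r < B₃ε₁` and `(6)(r) ⊆ (8)` outright. [cite: Balaban1985Variational, Prop 8 p.304, (6) and (8) pp.278-279] -/
theorem prop8Native_of_minimisersIn8At {L : ℕ} {a₅ B₃ : ℝ} (H : ∀ a₁ : ℝ, MinimisersIn8At L a₅ a₁ B₃) : Prop8NativeAt L a₅ B₃ := by
  intro F hF n K hnK ε₀ ε₁ hε₁ hε₀ V U hV hU hB hcrit
  obtain ⟨e, -, hUe, hmin⟩ := hcrit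
  -- `U` lies in (6) at the radius `r = min{e, ε₀}` and minimises there
  have hUr : U ∈ regFibrePr F n K hnK.le (min e ε₀) V := by
    rcases min_choice e ε₀ with hr | hr <;> rw [hr]
    · exact hUe
    · exact (mem_regFibrePr_iff F).mpr ⟨hB, hU⟩
  have hminr : IsMinOn (fun W : GaugeField (F.P K) 0 (Matrix.specialUnitaryGroup (Fin 2) ℂ) => wilsonAction4 W)
      (regFibrePr F n K hnK.le (min e ε₀) V) U :=
    hmin.on_subset (regFibrePr_mono F (min_le_left e ε₀) V)
  by_cases hcmp : B₃ * ε₁ ≤ min e ε₀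
  · have h8 := H ε₁ F hF n K hnK ε₁ (min e ε₀) hε₁ le_rfl hcmp ((min_le_right e ε₀).trans hε₀) V hV U hUr hminr
    exact ((mem_regFibrePr_iff F).mp h8).2
  · have h8 := regFibrePr_mono F (le_of_not_ge hcmp) V hUr
    exact ((mem_regFibrePr_iff F).mp h8).2

/-- **V2 ⟺ THE BIRTH'S SCHEMA, UNIFORMLY IN `a₁`**: `B11.Prop8Printed B₃ (famX L) ↔ ∃ a₅ > 0, ∀ a₁, MinimisersIn8At L a₅ a₁ B₃` (`→` is
`T3Thm1Carrier.minimisersIn8At_of_prop8` by name). [cite: Balaban1985Variational, Prop 8 p.304] -/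
theorem prop8Printed_famX_iff_minimisersIn8At {L : ℕ} {B₃ : ℝ} (hB₃ : 0 < B₃) :
    Prop8Printed B₃ (famX L) ↔ ∃ a₅ : ℝ, 0 < a₅ ∧ ∀ a₁ : ℝ, MinimisersIn8At L a₅ a₁ B₃ := by
  refine ⟨minimisersIn8At_of_prop8 hB₃, fun ⟨a₅, ha₅, H⟩ => ?_⟩
  exact prop8Printed_famX_iff_native.mpr ⟨a₅, ha₅, prop8Native_of_minimisersIn8At H⟩

end Prop8

/-! ## §3 (V4) The Sect. F conclusion (169) ⇒ (9)–(10) at the carrier: one surviving member -/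

section SectF

/-- **[Balaban1985Variational] SECT. F's CONCLUSION (9)–(10) AT THE T³ CARRIER, NATIVE FORM — THE SURVIVING MEMBER** (hypothesis schema, never
asserted): for every member `F` of block size `L`, heights `n < K`, `0 < ε₁ ≦ a₁`, every (7)-datum `V` and every `U ∈ (8) = 𝔘_k(B₃ε₁) ∩ 𝔅_k(V)`
which is critical in reading R2, EVERY backward covariant derivative ([Balaban1985RegularSpaces] (1.1)) of every plaquette field of `U` (read in
`M₂(ℂ)` through `SU(2) ≤ U(2)`, operator norm) satisfies `‖(D^{1*}_{U,ν}F_{κκ′})(x)‖ < B₄ε₁L^{−3(K−n)}` — the β₀ = 1 Hölder member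
`‖A‖_{1,β} < B₄(β₀)Mε₁(Lʲη)^{−2−β}` of (9) in `T3Thm1Carrier`'s reading R3 (point data, `M = 1`, `Lʲη = 1`, `η = L^{−(K−n)}`).  Print derives
(9)–(10) for critical configurations in Sect. F (p. 300: *«We will use only the fact that they are critical configurations of the functional (5) and
that they belong to the spaces (6) with ε₀ sufficiently small»*; p. 305: *«thus we take ε₀ = B₃ε₁»*); the Hölder member itself is cell gap G-B11-F3
(not derived in print; downstream [Balaban1987RG1] (3.31) uses `0 ≦ β ≦ β₀ < 1` and p. 285 *«we do not have bounds for second order derivatives of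
the field A»*) — this schema is the reading-R3 statement AS CONSUMED by the 19200 leaf V4, displayed, never asserted.
[cite: Balaban1985Variational, (9) p.279, Sect. F (169) p.305] -/
def CritCurvGradAt (L : ℕ) (a₁ B₃ B₄ : ℝ) : Prop :=
  ∀ F : T3Family, F.L = L → ∀ (n K : ℕ) (hnK : n < K) (ε₁ : ℝ), 0 < ε₁ → ε₁ ≤ a₁ →
    ∀ (V : GaugeField (F.P n) 0 (Matrix.specialUnitaryGroup (Fin 2) ℂ)) (U : GaugeField (F.P K) 0 (Matrix.specialUnitaryGroup (Fin 2) ℂ)),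
      PlaqSmall ε₁ V → RegPr F n K (B₃ * ε₁) U → U ∈ fibre F ℰp n K hnK.le V → IsCritR2 F n K hnK.le V U →
        ∀ (x : Site (F.P K) 0) (ν κ κ' : Fin (F.P K).d), κ ≠ κ' →
          ‖covDerivT 1 (unitsField (toUField U)) ν (plaqFT (unitsField (toUField U)) κ κ') x‖ < B₄ * ε₁ * ((F.L : ℝ)⁻¹) ^ (3 * (K - n))

variable {L : ℕ}

/-- `η³ > 0` bookkeeping: `L^{−3(K−n)} = (L^{−(K−n)})³ > 0`. [cite: Balaban1985Variational, (2) p.278] -/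
theorem eta_cube_pos (F : T3Family) (n K : ℕ) : (0 : ℝ) < (((F.L : ℝ)⁻¹) ^ (K - n)) ^ 3 :=
  pow_pos (pow_pos (inv_pos.mpr (L_cast_pos F)) _) 3

/-- `L^{−3(K−n)} = (L^{−(K−n)})³`. [cite: Balaban1985Variational, (2) p.278] -/
theorem eta_pow_three (F : T3Family) (n K : ℕ) : ((F.L : ℝ)⁻¹) ^ (3 * (K - n)) = (((F.L : ℝ)⁻¹) ^ (K - n)) ^ 3 := by
  rw [← pow_mul, mul_comm]

/-- `η⁻³·q < c ⟺ q < c·η³` (the carrier's prefactor `((L^{−(K−n)})⁻¹)³` moved across). [cite: Balaban1985Variational, (9)-(10) p.279] -/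
theorem eta_inv_cube_mul_lt_iff (F : T3Family) (n K : ℕ) (q c : ℝ) :
    ((((F.L : ℝ)⁻¹) ^ (K - n))⁻¹) ^ 3 * q < c ↔ q < c * ((F.L : ℝ)⁻¹) ^ (3 * (K - n)) := by
  rw [eta_pow_three, inv_pow, ← div_eq_inv_mul, div_lt_iff₀ (eta_cube_pos F n K)]

/-- **THE MEMBER (10) AT THE CARRIER IS (8)'s OWN DIVERGENCE CLAUSE**: for `U ∈ 𝔘_k(B₃ε₁)` (`RegPr`, second clause = [Balaban1985RegularSpaces]
(1.9) at the top scale, `DivSmall`), the carrier's `max{|∂^{η*}∂^ηA|, |Δ^ηA|}`-slot `η⁻³‖(D^{1*}_U∂U)_ν(x)‖` is `< B₃ε₁` at every point datum.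
[cite: Balaban1985Variational, (10) p.279, (2) p.278; Balaban1985RegularSpaces, (1.9) p.77] -/
theorem ineq10_famX_of_regPr {F : T3Family} {n K : ℕ} {B₃ ε₁ : ℝ} {U : GaugeField (F.P K) 0 (Matrix.specialUnitaryGroup (Fin 2) ℂ)}
    (hU : RegPr F n K (B₃ * ε₁) U) (x : Site (F.P K) 0) (ν : Fin (F.P K).d) :
    ((((F.L : ℝ)⁻¹) ^ (K - n))⁻¹) ^ 3 * ‖covDivT 1 (unitsField (toUField U)) ν x‖ < B₃ * ε₁ := by
  rw [eta_inv_cube_mul_lt_iff]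
  exact hU.divSmall ⟨x, ν⟩

/-- **V4 ⇐ THE NATIVE MEMBER**: `CritCurvGradAt L a₁ B₃ B₄` (`a₁, B₄ > 0`, `B₃ > 0`) GIVES `B11.SectFPrinted B₃ (famX L)` with `R_M = 1` — at a
point datum `(x, ν, κ, κ′)` the gauge slot is `True`, the |A|, |∇^ηA| slots read `0 < B₃ε₁`, the Hölder slot is the native member (or `0 < B₄ε₁`
when `κ = κ′`), and the (10) slot is (8)'s divergence clause (`ineq10_famX_of_regPr`); the cube-size proviso `M ≦ R_M·a₁/ε₁` is not needed.
[cite: Balaban1985Variational, Sect. F (169) p.305, (9)-(10) p.279] -/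
theorem sectFPrinted_famX_of_critCurvGrad {a₁ B₃ B₄ : ℝ} (hB₃ : 0 < B₃) (ha₁ : 0 < a₁) (hB₄ : 0 < B₄)
    (H : CritCurvGradAt L a₁ B₃ B₄) : SectFPrinted B₃ (famX L) := by
  refine ⟨a₁, B₄, 1, ha₁, hB₄, one_pos, ?_⟩
  intro i ε₁ V U hε₁ hε₁a hV hU hB hcrit c _hc
  obtain ⟨⟨F, n, K⟩, hF, hnK⟩ := i
  obtain ⟨x, ν, κ, κ'⟩ := c
  have hBε : 0 < B₃ * ε₁ := mul_pos hB₃ hε₁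
  have hB₄ε : 0 < B₄ * ε₁ := mul_pos hB₄ hε₁
  have hLη : (F.L : ℝ) ^ (K - n) * ((F.L : ℝ)⁻¹) ^ (K - n) = 1 := by
    rw [← mul_pow, mul_inv_cancel₀ (L_cast_pos F).ne', one_pow]
  have hreg : RegPr F n K (B₃ * ε₁) U := hU
  refine ⟨trivial, ?_, ?_, ?_, ?_⟩
  · show (0 : ℝ) < B₃ * 1 * ε₁ * ((F.L : ℝ) ^ (K - n) * ((F.L : ℝ)⁻¹) ^ (K - n))⁻¹ ^ 1
    rw [hLη, inv_one, one_pow, mul_one, mul_one]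
    exact hBε
  · show (0 : ℝ) < B₃ * 1 * ε₁ * ((F.L : ℝ) ^ (K - n) * ((F.L : ℝ)⁻¹) ^ (K - n))⁻¹ ^ 2
    rw [hLη, inv_one, one_pow, mul_one, mul_one]
    exact hBε
  · intro β _hβ0 _hβ1
    show (if κ ≠ κ' then ((((F.L : ℝ)⁻¹) ^ (K - n))⁻¹) ^ 3 *
        ‖covDerivT 1 (unitsField (toUField U)) ν (plaqFT (unitsField (toUField U)) κ κ') x‖ else 0) <
      B₄ * 1 * ε₁ * (((F.L : ℝ) ^ (K - n) * ((F.L : ℝ)⁻¹) ^ (K - n))⁻¹) ^ (2 + β)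
    rw [hLη, inv_one, Real.one_rpow, mul_one, mul_one]
    split_ifs with hne
    · rw [eta_inv_cube_mul_lt_iff]
      exact H F hF n K hnK ε₁ hε₁ hε₁a V U hV hreg hB hcrit x ν κ κ' hne
    · exact hB₄ε
  · show ((((F.L : ℝ)⁻¹) ^ (K - n))⁻¹) ^ 3 * ‖covDivT 1 (unitsField (toUField U)) ν x‖ <
      B₃ * 1 * ε₁ * ((F.L : ℝ) ^ (K - n) * ((F.L : ℝ)⁻¹) ^ (K - n))⁻¹ ^ 3
    rw [hLη, inv_one, one_pow, mul_one, mul_one]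
    exact ineq10_famX_of_regPr hreg x ν

/-- **V4 ⇒ THE NATIVE MEMBER**: from `B11.SectFPrinted B₃ (famX L)` (constants `a₁, B₄, R_M`), at `a₁′ = min{a₁, a₁R_M}` every point datum is a
cube of size `1 ≦ R_M·a₁/ε₁`, and the Hölder slot of (9) at `β = 1` unfolds to the native member (as in `T3Thm1Carrier.minimiserCurvGradAt_of_thm1At`).
[cite: Balaban1985Variational, (9) p.279, Sect. F (169) p.305] -/
theorem critCurvGrad_of_sectFPrinted {B₃ : ℝ} (H : SectFPrinted B₃ (famX L)) :
    ∃ a₁ B₄ : ℝ, 0 < a₁ ∧ 0 < B₄ ∧ CritCurvGradAt L a₁ B₃ B₄ := by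
  obtain ⟨aF, B₄, RM, haF, hB₄, hRM, HF⟩ := H
  refine ⟨min aF (aF * RM), B₄, lt_min haF (mul_pos haF hRM), hB₄, ?_⟩
  intro F hF n K hnK ε₁ hε₁ hε₁a V U hV hU hB hcrit x ν κ κ' hne
  -- the cover: a point datum has size `1 ≤ R_M·a_F/ε₁`
  have hcov : (famX L ⟨(F, n, K), hF, hnK⟩).sizeM (x, ν, κ, κ') ≤ RM * (aF / ε₁) := by
    show (1 : ℝ) ≤ RM * (aF / ε₁)
    rw [mul_comm, div_mul_eq_mul_div, le_div_iff₀ hε₁, one_mul]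
    exact hε₁a.trans (min_le_right _ _)
  have hR := HF ⟨(F, n, K), hF, hnK⟩ ε₁ V U hε₁ (hε₁a.trans (min_le_left _ _)) hV hU hB hcrit (x, ν, κ, κ') hcov
  obtain ⟨-, -, -, hholder, -⟩ := hR
  have h1 := hholder 1 zero_le_one le_rfl
  have hse : (famX L ⟨(F, n, K), hF, hnK⟩).L ^ (famX L ⟨(F, n, K), hF, hnK⟩).scale (x, ν, κ, κ') *
      (famX L ⟨(F, n, K), hF, hnK⟩).eta = 1 := scale_mul_eta
  rw [hse, inv_one, Real.one_rpow, mul_one] at h1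
  change (if κ ≠ κ' then ((((F.L : ℝ)⁻¹) ^ (K - n))⁻¹) ^ 3 *
      ‖covDerivT 1 (unitsField (toUField U)) ν (plaqFT (unitsField (toUField U)) κ κ') x‖ else 0) < B₄ * 1 * ε₁ at h1
  rw [if_pos hne, mul_one] at h1
  exact (eta_inv_cube_mul_lt_iff F n K _ _).mp h1

/-- **V4 ⟺ THE NATIVE MEMBER**: `B11.SectFPrinted B₃ (famX L) ↔ ∃ a₁ B₄ > 0, CritCurvGradAt L a₁ B₃ B₄` (`B₃ > 0`).  At the d = 3 carrier the Sect. F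
leaf of the 19200 census is exactly the covariant-gradient-of-curvature bound for (8)-regular critical configurations.
[cite: Balaban1985Variational, Sect. F (169) p.305, (9)-(10) p.279] -/
theorem sectFPrinted_famX_iff {B₃ : ℝ} (hB₃ : 0 < B₃) :
    SectFPrinted B₃ (famX L) ↔ ∃ a₁ B₄ : ℝ, 0 < a₁ ∧ 0 < B₄ ∧ CritCurvGradAt L a₁ B₃ B₄ :=
  ⟨critCurvGrad_of_sectFPrinted, fun ⟨_, _, ha₁, hB₄, H⟩ => sectFPrinted_famX_of_critCurvGrad hB₃ ha₁ hB₄ H⟩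

/-- **THE BIRTH's `MinimiserCurvGradAt` FROM THE TWO NATIVE LEAVES** (the natively-proved twin of `T3Thm1Carrier.minimiserCurvGradAt_of_thm1At`,
without Theorem 1): a minimiser over (6)(ε₀), `B₃ε₁ ≦ ε₀ ≦ a₅`, lies in (8) by the Prop-8 schema and is reading-R2-critical with `e = ε₀`, so the
native Sect. F member applies. [cite: Balaban1985Variational, Prop 8 p.304, (9)-(10) p.279] -/
theorem minimiserCurvGradAt_of_native {a₅ a₁ B₃ B₄ : ℝ} (hB₃ : 0 < B₃) (H8 : ∀ a : ℝ, MinimisersIn8At L a₅ a B₃)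
    (HF : CritCurvGradAt L a₁ B₃ B₄) : MinimiserCurvGradAt L a₅ a₁ B₃ B₄ := by
  intro F hF n K hnK ε₁ ε₀ hε₁ hε₁a hlo hhi V hV U hU hmin x ν κ κ' hne
  have hU8 : U ∈ regFibrePr F n K hnK.le (B₃ * ε₁) V := H8 a₁ F hF n K hnK ε₁ ε₀ hε₁ hε₁a hlo hhi V hV U hU hmin
  have hcrit : IsCritR2 F n K hnK.le V U := isCritR2_of_isMinOn ((mul_pos hB₃ hε₁).trans_le hlo) hU hmin
  exact HF F hF n K hnK ε₁ hε₁ hε₁a V U hV ((mem_regFibrePr_iff F).mp hU8).2 hU8.1.1 hcrit x ν κ κ' hne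

/-- **NON-VACUITY of V4's conclusion**: at the trivial configuration every covariant derivative of every plaquette field vanishes
(`F ≡ 1`, `R(1)1 − 1 = 0`). [cite: Balaban1985RegularSpaces, (1.1)-(1.2) p.76] -/
theorem curvGrad_one (F : T3Family) (K : ℕ) (x : Site (F.P K) 0) (ν κ κ' : Fin (F.P K).d) :
    covDerivT 1 (unitsField (toUField (1 : GaugeField (F.P K) 0 (Matrix.specialUnitaryGroup (Fin 2) ℂ)))) ν
      (plaqFT (unitsField (toUField (1 : GaugeField (F.P K) 0 (Matrix.specialUnitaryGroup (Fin 2) ℂ)))) κ κ') x = 0 := by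
  rw [unitsField_toUField_one]
  have hF : plaqFT (fun _ : PBond (F.P K) 0 => (1 : (Matrix (Fin 2) (Fin 2) ℂ)ˣ)) κ κ' = fun _ => 1 := by
    funext z; unfold plaqFT; rw [holT_one, Units.val_one]
  rw [hF]
  unfold covDerivT
  simp only [conjR_apply, inv_one, Units.val_one, mul_one, sub_self, smul_zero]

/-- Hence the native member holds at the flat datum for every `B₄, ε₁ > 0` (its hypotheses are met there: `isCritR2_one`, `regPr_one`).
[cite: Balaban1985Variational, (9) p.279] -/
theorem curvGrad_bound_one (F : T3Family) (n K : ℕ) {B₄ ε₁ : ℝ} (hB₄ : 0 < B₄) (hε₁ : 0 < ε₁) (x : Site (F.P K) 0)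
    (ν κ κ' : Fin (F.P K).d) :
    ‖covDerivT 1 (unitsField (toUField (1 : GaugeField (F.P K) 0 (Matrix.specialUnitaryGroup (Fin 2) ℂ)))) ν
        (plaqFT (unitsField (toUField (1 : GaugeField (F.P K) 0 (Matrix.specialUnitaryGroup (Fin 2) ℂ)))) κ κ') x‖ <
      B₄ * ε₁ * ((F.L : ℝ)⁻¹) ^ (3 * (K - n)) := by
  rw [curvGrad_one, norm_zero, eta_pow_three]
  exact mul_pos (mul_pos hB₄ hε₁) (eta_cube_pos F n K)

end SectF

/-! ## §4 (V3) Proposition 7 from a background (14) at the carrier, named, and its native form -/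

section Prop7

/-- **[Balaban1985Variational] PROP. 7 PROVED FROM A BACKGROUND (14), AT THE T³ CARRIER** (hypothesis schema, never asserted) — LITERALLY the
hypothesis `H7` of `Summit.QuantumFields.YangMills.Theorems.Variational.thm1At_fam_of_prop7_prop8_sectF` (leaf V3 of the 19200 census), NAMED:
constants `a₀, a′₁ > 0`, `O(1) ≧ 1` before the member; for every (7)-datum `V` and every background `U₀ ∈ 𝔘_k(L³B₃ε₁) ∩ 𝔅_k(V)` ((14) with
`C₁ = L³` in the carrier's reading: `InU (L³B₃ε₁) U₀ ∧ InB V U₀`): *«for ε₀ ≦ a₀ and B₃ε₁ ≦ ε₀ the variational problem (5), (6) has at most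
one critical orbit»* and *«If ε₁ ≦ a′₁, then there exists a minimal orbit in the space (6) with ε₀ = O(1)C₁B₃ε₁»* (cf. `B11.Prop7Printed`,
`B11Thm1.Prop7From14` over a tower; cell gap G-pv12-1: Prop. 7 is printed under the standing background of Sect. A).
[cite: Balaban1985Variational, Prop 7 p.299, (14) p.280] -/
def Prop7From14At (L : ℕ) (B₃ : ℝ) : Prop :=
  ∃ a₀ a₁' O₁ : ℝ, 0 < a₀ ∧ 0 < a₁' ∧ 1 ≤ O₁ ∧
    ∀ (i : Idx L) (ε₀ ε₁ : ℝ), 0 < ε₁ → ∀ V : (famX L i).Bdry, (famX L i).Reg7 ε₁ V →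
      ∀ U₀ : (famX L i).Cfg, (famX L i).InU ((L : ℝ) ^ 3 * B₃ * ε₁) U₀ → (famX L i).InB V U₀ →
        (ε₀ ≤ a₀ → B₃ * ε₁ ≤ ε₀ → (famX L i).AtMostOneCriticalOrbit ε₀ V) ∧
        (ε₁ ≤ a₁' → ∃ U : (famX L i).Cfg, (famX L i).OnMinimalOrbit (O₁ * (L : ℝ) ^ 3 * B₃ * ε₁) V U)

/-- **PROP. 7 FROM A BACKGROUND (14) AT THE T³ CARRIER, NATIVE FORM** (hypothesis schema, never asserted): the same at given constants,
member by member in the family's vocabulary — uniqueness clause: any two reading-R2-critical configurations in `𝔘_k(ε₀) ∩ 𝔅_k(V)` lie on one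
orbit of print's group (4) (`T3Thm1Carrier.SameOrbit`: gauge transformations with `u↓ = 1`); existence clause: a minimiser of the Wilson action
over `(6)(O(1)·L³B₃ε₁)` exists (reading R1). [cite: Balaban1985Variational, Prop 7 p.299, (4) p.278, (14) p.280] -/
def Prop7From14NativeAt (L : ℕ) (a₀ a₁' O₁ B₃ : ℝ) : Prop :=
  ∀ F : T3Family, F.L = L → ∀ (n K : ℕ) (hnK : n < K) (ε₀ ε₁ : ℝ), 0 < ε₁ →
    ∀ V : GaugeField (F.P n) 0 (Matrix.specialUnitaryGroup (Fin 2) ℂ), PlaqSmall ε₁ V →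
      ∀ U₀ : GaugeField (F.P K) 0 (Matrix.specialUnitaryGroup (Fin 2) ℂ), RegPr F n K ((L : ℝ) ^ 3 * B₃ * ε₁) U₀ →
        U₀ ∈ fibre F ℰp n K hnK.le V →
          (ε₀ ≤ a₀ → B₃ * ε₁ ≤ ε₀ →
            ∀ U U' : GaugeField (F.P K) 0 (Matrix.specialUnitaryGroup (Fin 2) ℂ),
              RegPr F n K ε₀ U → U ∈ fibre F ℰp n K hnK.le V → IsCritR2 F n K hnK.le V U →
              RegPr F n K ε₀ U' → U' ∈ fibre F ℰp n K hnK.le V → IsCritR2 F n K hnK.le V U' →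
                T3Thm1Carrier.SameOrbit F n K hnK.le U U') ∧
          (ε₁ ≤ a₁' → ∃ U ∈ regFibrePr F n K hnK.le (O₁ * (L : ℝ) ^ 3 * B₃ * ε₁) V,
            IsMinOn (fun W : GaugeField (F.P K) 0 (Matrix.specialUnitaryGroup (Fin 2) ℂ) => wilsonAction4 W)
              (regFibrePr F n K hnK.le (O₁ * (L : ℝ) ^ 3 * B₃ * ε₁) V) U)

/-- **V3 UNFOLDED**: `Prop7From14At L B₃ ↔ ∃ a₀ a′₁ O₁, 0 < a₀ ∧ 0 < a′₁ ∧ 1 ≦ O₁ ∧ Prop7From14NativeAt L a₀ a′₁ O₁ B₃` (definitional unfolding of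
the carrier, member by member). [cite: Balaban1985Variational, Prop 7 p.299] -/
theorem prop7From14At_iff_native {L : ℕ} {B₃ : ℝ} :
    Prop7From14At L B₃ ↔ ∃ a₀ a₁' O₁ : ℝ, 0 < a₀ ∧ 0 < a₁' ∧ 1 ≤ O₁ ∧ Prop7From14NativeAt L a₀ a₁' O₁ B₃ := by
  constructor
  · rintro ⟨a₀, a₁', O₁, ha₀, ha₁', hO₁, H⟩
    refine ⟨a₀, a₁', O₁, ha₀, ha₁', hO₁, fun F hF n K hnK ε₀ ε₁ hε₁ V hV U₀ hU₀ hB => ?_⟩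
    exact H ⟨(F, n, K), hF, hnK⟩ ε₀ ε₁ hε₁ V hV U₀ hU₀ hB
  · rintro ⟨a₀, a₁', O₁, ha₀, ha₁', hO₁, H⟩
    refine ⟨a₀, a₁', O₁, ha₀, ha₁', hO₁, fun i ε₀ ε₁ hε₁ V hV U₀ hU₀ hB => ?_⟩
    obtain ⟨⟨F, n, K⟩, hF, hnK⟩ := i
    exact H F hF n K hnK ε₀ ε₁ hε₁ V hV U₀ hU₀ hB

/-- **NON-VACUITY of V3's hypotheses**: the flat datum `V ≡ 1` with the flat background `U₀ ≡ 1` meets (7) and (14) at the carrier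
(`PlaqSmall ε₁ 1`, `1 ∈ 𝔘_k(L³B₃ε₁) ∩ 𝔅_k(1)`) for `ε₁, B₃ > 0`, `L ≧ 1`. [cite: Balaban1985Variational, (7) p.278, (14) p.280] -/
theorem prop7From14_hypotheses_one (F : T3Family) (n K : ℕ) (h : n ≤ K) {B₃ ε₁ : ℝ} (hB₃ : 0 < B₃) (hε₁ : 0 < ε₁) :
    PlaqSmall ε₁ (1 : GaugeField (F.P n) 0 (Matrix.specialUnitaryGroup (Fin 2) ℂ)) ∧
      RegPr F n K ((F.L : ℝ) ^ 3 * B₃ * ε₁) (1 : GaugeField (F.P K) 0 (Matrix.specialUnitaryGroup (Fin 2) ℂ)) ∧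
      (1 : GaugeField (F.P K) 0 (Matrix.specialUnitaryGroup (Fin 2) ℂ)) ∈
        fibre F ℰp n K h (1 : GaugeField (F.P n) 0 (Matrix.specialUnitaryGroup (Fin 2) ℂ)) := by
  have hr : 0 < (F.L : ℝ) ^ 3 * B₃ * ε₁ := mul_pos (mul_pos (pow_pos (L_cast_pos F) 3) hB₃) hε₁
  exact ⟨plaqSmall_one hε₁, regPr_one hr, (one_mem_regFibrePr_one F (h := h) hr).1.1⟩

end Prop7

/-! ## §5 (V2, one step) The halving step of Sect. F's first case at the carrier, native form (v1.2 append) -/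

section Halving

/-- **THE ONE-STEP CONCLUSION OF SECT. F's FIRST CASE AT THE T³ CARRIER, NATIVE FORM** (hypothesis schema, never asserted) — the located
hypothesis `B11Prop8Assembly.HalvingStep` (p. 304 [PDF 28], verbatim: *«we conclude that U′_k satisfies (2) on Δ₀ with max{B₃ε₁, ½ε₀} instead of
ε₀. The cube Δ₀ is an arbitrary cube Δ(y) = Bʲ(y), if y ∈ Λ_j, hence U_k belongs to the space (2) with max{B₃ε₁, ½ε₀} instead of ε₀. If ½ε₀ ≦ B₃ε₁,
then the required regularity is proved. If ½ε₀ > B₃ε₁, then we apply again the whole reasoning with ½ε₀ instead of ε₀. We continue this way until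
we reach the bound B₃ε₁.»*) read at `famX L`: for `0 < ε₁`, `ε₀ ≦ a₅`, every (7)-datum `V` and every reading-R2-critical `U ∈ 𝔘_k(ε₀)` in the
fibre of `V`: `U ∈ 𝔘_k(max{B₃ε₁, ½ε₀})` (both clauses of (2), `RegPr`).  This is the statement a d = 3 prover of V2 proves ONCE; the iteration
to (8) is `B11Prop8Assembly.prop8Printed_of_halvingStep` by name (`prop8Printed_famX_of_halvingNative`).
[cite: Balaban1985Variational, Sect. F p.304, Prop 8 p.304] -/
def HalvingNativeAt (L : ℕ) (a₅ B₃ : ℝ) : Prop :=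
  ∀ F : T3Family, F.L = L → ∀ (n K : ℕ) (hnK : n < K) (ε₀ ε₁ : ℝ), 0 < ε₁ → ε₀ ≤ a₅ →
    ∀ (V : GaugeField (F.P n) 0 (Matrix.specialUnitaryGroup (Fin 2) ℂ)) (U : GaugeField (F.P K) 0 (Matrix.specialUnitaryGroup (Fin 2) ℂ)),
      PlaqSmall ε₁ V → RegPr F n K ε₀ U → U ∈ fibre F ℰp n K hnK.le V → IsCritR2 F n K hnK.le V U →
        RegPr F n K (max (B₃ * ε₁) (ε₀ / 2)) U

variable {L : ℕ}

/-- **UNFOLDED**: the located hypothesis `HalvingStep` at every member of `famX L` IS `HalvingNativeAt` (definitional, member by member).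
[cite: Balaban1985Variational, Sect. F p.304] -/
theorem halvingStep_famX_iff_native {a₅ B₃ : ℝ} :
    (∀ i : Idx L, B11Prop8Assembly.HalvingStep (famX L i) B₃ a₅) ↔ HalvingNativeAt L a₅ B₃ := by
  constructor
  · intro H F hF n K hnK ε₀ ε₁ hε₁ hε₀ V U hV hU hB hcrit
    exact (H ⟨(F, n, K), hF, hnK⟩).step ε₀ ε₁ V U hε₁ hV hU hB hcrit hε₀
  · intro H i
    obtain ⟨⟨F, n, K⟩, hF, hnK⟩ := i
    exact ⟨fun ε₀ ε₁ V U hε₁ hV hU hB hcrit hε₀ => H F hF n K hnK ε₀ ε₁ hε₁ hε₀ V U hV hU hB hcrit⟩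

/-- The spaces (2) at the carrier are monotone in the radius (`regPr_mono`) — the dictionary law `prop8Printed_of_halvingStep` asks for.
[cite: Balaban1985Variational, (2) p.278] -/
theorem inU_famX_mono (i : Idx L) (e e' : ℝ) (U : (famX L i).Cfg) (he : e ≤ e') (hU : (famX L i).InU e U) :
    (famX L i).InU e' U := by
  obtain ⟨⟨F, n, K⟩, hF, hnK⟩ := i
  exact regPr_mono F he hU

/-- **V2 ⇐ THE NATIVE ONE-STEP HALVING** («We continue this way until we reach the bound B₃ε₁» = `B11Prop8Assembly.prop8Printed_of_halvingStep`
BY NAME): `HalvingNativeAt L a₅ B₃` with `a₅, B₃ > 0` gives the leaf `B11.Prop8Printed B₃ (famX L)`. [cite: Balaban1985Variational, Prop 8 p.304] -/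
theorem prop8Printed_famX_of_halvingNative {a₅ B₃ : ℝ} (hB₃ : 0 < B₃) (ha₅ : 0 < a₅) (H : HalvingNativeAt L a₅ B₃) :
    Prop8Printed B₃ (famX L) :=
  B11Prop8Assembly.prop8Printed_of_halvingStep (famX L) hB₃ ha₅ (fun i e e' U he hU => inU_famX_mono i e e' U he hU)
    (halvingStep_famX_iff_native.mpr H)

/-- … and hence Prop. 8 at the carrier in native form (some `a₅′ > 0`). [cite: Balaban1985Variational, Prop 8 p.304] -/
theorem prop8Native_of_halvingNative {a₅ B₃ : ℝ} (hB₃ : 0 < B₃) (ha₅ : 0 < a₅) (H : HalvingNativeAt L a₅ B₃) :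
    ∃ a₅' : ℝ, 0 < a₅' ∧ Prop8NativeAt L a₅' B₃ :=
  prop8Printed_famX_iff_native.mp (prop8Printed_famX_of_halvingNative hB₃ ha₅ H)

/-- **NON-VACUITY of the one-step schema's conclusion** at the flat datum: `1 ∈ 𝔘_k(max{B₃ε₁, ½ε₀})` for `B₃, ε₁ > 0`.
[cite: Balaban1985Variational, (2) p.278] -/
theorem halving_conclusion_one (F : T3Family) (n K : ℕ) {B₃ ε₀ ε₁ : ℝ} (hB₃ : 0 < B₃) (hε₁ : 0 < ε₁) :
    RegPr F n K (max (B₃ * ε₁) (ε₀ / 2)) (1 : GaugeField (F.P K) 0 (Matrix.specialUnitaryGroup (Fin 2) ℂ)) :=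
  regPr_one ((mul_pos hB₃ hε₁).trans_le (le_max_left _ _))

end Halving

end Literature.MathematicalPhysics.QuantumFieldTheory.Balaban1983to89.T3Thm1CarrierNative

end
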